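import Summits.BirchSwinnertonDyer.BirchSwinnertonDyer.Theses.AlignedTransportAtTwo
import Summits.BirchSwinnertonDyer.BirchSwinnertonDyer.Theorems.AlignedTransportAtTwoBSDOfMainConjectureRankOneAtTwoLeadingTermViaTwoAdicBSD
import Summits.BirchSwinnertonDyer.BirchSwinnertonDyer.Theorems.AlignedTransportAtTwoBSDOfMainConjectureRankOneAtTwoSigmaSqTwoExistence
import HarnessLib

/-! # Line `lfunction` (ALTERNATIVE, unregistered; lead `bsd-line-att-p1` g2; v2 = att-p3 g10: `stub_sigmaSqTwo` CLOSED BY NAME via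
`…Theorems.AlignedTransportAtTwoSigmaSqTwo.mazurTate_sigmaSq_existsUnique_two_holds`, p644698 — nothing else changed; hMT-free closure =
`…Theorems.AlignedTransportAtTwoSigmaSqTwoDischarge.bsdOfMainConjectureRankOneAtTwo_of_twoAdicBSDValAt_of_shaAnTransferAt`, p645929) — crux
`Summit.BirchSwinnertonDyer.BirchSwinnertonDyer.Theses.AlignedTransportAtTwo.BSDOfMainConjectureRankOneAtTwo` (stmt-BirchSwinnertonDyer-23008, C3′).

The `L`-FUNCTION route: C3′ from the cell's NAMED `2`-adic BSD statements (-es lens, `F1Sign2/TwoAdicBSDRankOneAtTwo.lean`, p596807) —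
per-curve K2-Gv `TwoAdicBSDValRankOneAt` (BMS Conj 1.4 at 2 in norm form: conjecture-grade at EVERY p) and K2-G′v `TwoAdicShaAnTransferRankOneAt`
(Perrin-Riou transfer in `#Ш_an` form) — restricted to the cell, plus four PRINT facts, through the landed closure
`AlignedTransportAtTwoLeadingTermViaTwoAdicBSD.bsdOfMainConjectureRankOneAtTwo_of_twoAdicBSDValAt_of_shaAnTransferAt` (p597165). On this route the
crux's main-conjecture binder is IDLE (the laws speak of `L₂` directly); the line of record remains `Lines/birth.lean` (MC-route: Schneider's
CHARACTERISTIC-SERIES leading term at 2 + MC₂ + simple zero), whose by-name v2 waits for the typer's `SchneiderPerrinRiouAtTwo.lean`. This file is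
published so the ledger's cone sees C3′ ⟸ {K2-Gv, K2-G′v} by name today. Every `stub_*` is `sorry`; BSD is not proved; C3′ stays OPEN. -/

set_option linter.dupNamespace false

noncomputable section

namespace Summit.BirchSwinnertonDyer.BirchSwinnertonDyer.Cruxes.BSDOfMainConjectureRankOneAtTwo.LFunction

open Summit.BirchSwinnertonDyer.BirchSwinnertonDyer.Theses.AlignedTransportAtTwo
open Literature.NumberTheory.EllipticCurves Literature.NumberTheory.EllipticCurves.ModularForms
  Literature.NumberTheory.EllipticCurves.Greenberg1999 Summit.BirchSwinnertonDyer.Rank1Residual.F1Sign2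

/-- stub — OPEN (conjecture at every p): the cell's K2-Gv on the C3′ cell, per-curve form BY NAME. [cite: BalakrishnanMullerStein2015, Conj. 1.4] -/
theorem stub_twoAdicBSDValOnCell :
    ∀ (W : WeierstrassCurve ℚ) [W.IsElliptic] [W.IsGloballyMinimal],
      ¬ W.HasCM → (∀ x : ℚ, ¬ HasRationalTwoTorsionX W x) → ¬ IsSquare W.Δ → TwoAdicBSDValRankOneAt W := by
  sorry

/-- stub — OPEN at 2: the cell's K2-G′v on the C3′ cell, per-curve form BY NAME. [cite: PerrinRiou1987] -/
theorem stub_shaAnTransferOnCell :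
    ∀ (W : WeierstrassCurve ℚ) [W.IsElliptic] [W.IsGloballyMinimal],
      ¬ W.HasCM → (∀ x : ℚ, ¬ HasRationalTwoTorsionX W x) → ¬ IsSquare W.Δ → TwoAdicShaAnTransferRankOneAt W := by
  sorry

/-- stub — PRINT: Gross–Zagier–Kolyvagin. [cite: GrossZagier1986] [cite: Kolyvagin1990] -/
theorem stub_gzk : rank_eq_analyticRank_of_analyticRank_le_one := by
  sorry

/-- stub — PRINT: modularity (`exists_isNewformOf`). [cite: DiamondShurman2005, Thm. 8.8.3] -/
theorem stub_modularity : exists_isNewformOf := by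
  sorry

/-- stub — PRINT: the period unit at 2 (Abbes–Ullmo Thm A + GV Rem 3.4). [cite: AbbesUllmo1996, Thm. A] -/
theorem stub_periodUnitAtTwo : realPeriodRat_eq_unit_mul_plusPeriod_two := by
  sorry

/-- stub — PRINT, CLOSED (v2, no sorry): the Mazur–Tate Σ² division series at 2 (height receptacle), discharged by att-p3 g8/g9 (p644698).
[cite: MazurTate1991, Thm. 3.1] [cite: Silverman2005DivPoly, §5 Rem. 2] -/
theorem stub_sigmaSqTwo : mazurTate_sigmaSq_existsUnique_two :=
  Summit.BirchSwinnertonDyer.BirchSwinnertonDyer.Theorems.AlignedTransportAtTwoSigmaSqTwo.mazurTate_sigmaSq_existsUnique_two_holds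

/-- Composition (kernel-checked): the crux BY NAME through the landed L-function-route closure (p597165). -/
theorem BSDOfMainConjectureRankOneAtTwo_of : BSDOfMainConjectureRankOneAtTwo :=
  Summit.BirchSwinnertonDyer.BirchSwinnertonDyer.Theorems.AlignedTransportAtTwoLeadingTermViaTwoAdicBSD.bsdOfMainConjectureRankOneAtTwo_of_twoAdicBSDValAt_of_shaAnTransferAt
    stub_twoAdicBSDValOnCell stub_shaAnTransferOnCell stub_gzk stub_modularity stub_periodUnitAtTwo stub_sigmaSqTwo

end Summit.BirchSwinnertonDyer.BirchSwinnertonDyer.Cruxes.BSDOfMainConjectureRankOneAtTwo.LFunction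

end
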